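import Mathlib
import HarnessLib
import Literature.Analysis.FluidPDE.ClassicalSolution
import Literature.Analysis.FluidPDE.ClassicalSolutionCalculus
import Literature.Analysis.FluidPDE.ClassicalSolutionProofs
import Literature.Analysis.FluidPDE.RapidDecayLemmas
import Literature.Analysis.FluidPDE.NSVorticityHelicityProofs
import Literature.Analysis.FluidPDE.HydrodynamicImpulse
import Literature.Analysis.FluidPDE.HydrodynamicImpulseVector
import Literature.Analysis.FluidPDE.VectorCalculus
import Literature.Analysis.FluidPDE.Vorticity
import Literature.Analysis.FluidPDE.VorticityEquation
import Literature.Analysis.FluidPDE.WholeSpaceIBP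
import Literature.Analysis.FluidPDE.PineauVicolEnstrophy
import Literature.Analysis.FluidPDE.LocalBiotSavartCalculus
import Literature.Analysis.FluidPDE.NewtonKernel
import Literature.Analysis.FluidPDE.LeiZhang2011Cutoff
import Literature.Analysis.FluidPDE.TaoEnstrophyLocalisation
import Literature.Analysis.FluidPDE.EnergyToolkit
import Literature.Analysis.FluidPDE.EnergyUniqueness
import Literature.Analysis.FluidPDE.VorticityCalculus
import Literature.Analysis.FluidPDE.VectorCalculusProofs
import Literature.Analysis.FluidPDE.LeiZhang2011Proofs
import Summits.NavierStokesRegularity.NavierStokesRegularity.Theorems.EulerMelnikovDssPeriodMomentLawsAngularImpulseTools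
import Summits.NavierStokesRegularity.NavierStokesRegularity.Theorems.EulerMelnikovDssPeriodMomentLawsAngularImpulseViscousPressure

/-!
# Period moment laws of the rescaled Euler–Leray system, III-c: the ANGULAR-IMPULSE law (ii)
  (item stmt-NavierStokesRegularity-1419, `EulerMelnikovDss.PeriodMomentLaws`; helper file)

Setting of the item: `ε > 0` and a classical solution `(W, q)` on `ℝ × ℝ³` of the Navier–Stokes
system with viscosity `ε` and force `f(σ, y) = −(ε/2)(W(σ, y) + DW(σ, y) y)` — the rescaled
Euler–Leray system `∂_σW + (W·∇)W + ∇q = ε(ΔW − ½(W + (y·∇)W))` — with uniformly rapidly decaying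
velocity (`HasUniformRapidDecayOn univ W`). Law (ii) of the item:

  `d/dσ ∫ |y|² curl W(σ) dy = (3ε/2) ∫ |y|² curl W(σ) dy`   (`angularImpulse_law`).

It is the angular-impulse law `A' = (3ε/2)A`, `A = ∫ y × W`, in disguise (`∫ |y|² curl V = −2 ∫ y × V`,
parts III-a `…AngularImpulseTools`, III-b `…AngularImpulseViscousPressure`). Testing the momentum equation against the Killing fields
`y ↦ eᵢ × y`: the viscous term gives `∫ y × ΔV = −∫ y × curl curl V = 0` (the hydrodynamic impulse
of the integrable divergence-free field `curl V` vanishes — tree `integral_cross_curl_eq_zero_of_isDivFree`;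
`integral_cross_laplacian_apply_eq_zero`); the transport term gives `∫ y × (DV·V) = 0` (part III-a);
the PRESSURE gives `∫ y × ∇q = 0` with NO decay of `q` — against the radial cut-off `θ_R` of the
tree, `∫ θ_R ⟪eᵢ × y, ∇q⟫ = −∫ q div(θ_R (eᵢ × y)) = 0` exactly since `Dθ_R(y) ∥ ⟪y, ·⟫` annihilates
`eᵢ × y`, then `R → ∞` (`integral_cross_gradient_apply_eq_zero`; `∇q = εΔW − ∂_σW − (W·∇)W + f`
decays like `(1+|y|)⁻⁵`); the drift gives `∫ y × (DW·y) = −4A`, so `∫ y × ∂_σW = (3ε/2)A`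
(`integral_cross_timeDerivWithin_apply_eq`). The `σ`-derivative is taken under the integral sign
(domination by the uniform decay of `D∂_σW`, `hasDerivWithinAt_integral_of_dominated_convex`,
`∂_σ curl = curl ∂_σ`).

With `PeriodMomentLaws.impulse_law` (i), `energy_law` (iii, correctly parenthesised) and
`helicity_law` (iv) of the sibling files, all four laws of the item are now tree theorems; the item
itself closes once its law (iii) is re-parenthesised (see the reading note in
`EulerMelnikovDssPeriodMomentLawsEnergy.lean`).

HONEST FRAMING: calculus identities about HYPOTHETICAL smooth rapidly decaying solutions of the
rescaled system (putative self-similar-variable blow-up profiles); nothing here bears on NS regularity.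

References: P. G. Saffman, *Vortex Dynamics* (1992), §3.2 (3.2.11)–(3.2.15), §3.5 [cite: Saffman1992, §3.5];
A. J. Majda, A. L. Bertozzi, *Vorticity and Incompressible Flow* (2002), §1.7 Prop. 1.12
[cite: MajdaBertozziCUP2002, §1.7 Prop. 1.12].
-/

noncomputable section

set_option linter.dupNamespace false

namespace Summit.NavierStokesRegularity.NavierStokesRegularity.Theorems

namespace PeriodMomentLaws

open MeasureTheory Set Filter Topology InnerProductSpace Literature.Analysis.FluidPDE
open scoped RealInnerProductSpace NNReal ENNReal ContDiff Laplacian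

/-! ### Law (ii): the angular impulse of the rescaled Euler–Leray system -/

section Law

variable {ε : ℝ} {W : ℝ → EuclideanSpace ℝ (Fin 3) → EuclideanSpace ℝ (Fin 3)}
  {q : ℝ → EuclideanSpace ℝ (Fin 3) → ℝ}

/-- Merging decay constants: `a ≤ A w`, `A ≤ B`, `0 ≤ w` give `a ≤ B w`. [folklore] -/
theorem le_mul_weight_of_le {a A B w : ℝ} (h : a ≤ A * w) (hAB : A ≤ B) (hw : 0 ≤ w) : a ≤ B * w :=
  h.trans (mul_le_mul_of_nonneg_right hAB hw)

/-- **The instantaneous angular-impulse law.** For a classical solution `(W, q)` of the rescaled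
Euler–Leray system with uniformly rapidly decaying velocity, at every `σ` and for every component:
`∫ (y × ∂_σW(σ))ᵢ = (3ε/2) ∫ (y × W(σ))ᵢ` — the viscous, transport and pressure terms of
`∂_σW = εΔW − (W·∇)W − ∇q − (ε/2)(W + DW·y)` integrate to zero against `y × ·`
(`integral_cross_laplacian_apply_eq_zero`, `integral_cross_convect_apply_eq_zero`,
`integral_cross_gradient_apply_eq_zero`), and the drift gives `−(ε/2)(A − 4A)`
(`integral_cross_fderiv_apply_self_eq`). [cite: Saffman1992, §3.5] -/
theorem integral_cross_timeDerivWithin_apply_eq (hε : 0 < ε)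
    (hsol : IsClassicalNSSolutionOn Set.univ ε
      (fun σ y => -((ε / 2) • (W σ y + fderiv ℝ (W σ) y y))) W q)
    (hdec : HasUniformRapidDecayOn Set.univ W) (σ : ℝ) (i : Fin 3) :
    ∫ y, cross y (timeDerivWithin Set.univ W σ y) i = (3 * ε / 2) * ∫ y, cross y (W σ y) i := by
  have hU : UniqueDiffOn ℝ (Set.univ : Set ℝ) := uniqueDiffOn_univ
  have hσ : σ ∈ (Set.univ : Set ℝ) := mem_univ σ
  have hsm := hsol.smooth_velocity
  have hV : ContDiff ℝ ∞ (W σ) := hsol.contDiff_velocity hσ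
  have hV2 : ContDiff ℝ 2 (W σ) := hV.of_le (by norm_cast)
  have hV1 : ContDiff ℝ 1 (W σ) := hV.of_le (by norm_cast)
  have hq1 : ContDiff ℝ 1 (q σ) := (hsol.smooth_pressure.contDiff_slice hσ).of_le (by norm_cast)
  have hdivV : VectorCalculus.IsDivFree (W σ) := hsol.divFree σ hσ
  -- decay constants
  obtain ⟨A0, hA0, h0⟩ := hdec.norm_le_rpow 6
  obtain ⟨A1, hA1, h1⟩ := hdec.norm_fderiv_le_rpow hsm hU 6
  obtain ⟨A2, hA2, h2⟩ := hdec.norm_fderiv_fderiv_le_rpow hsm hU 6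
  obtain ⟨A3, hA3, h3⟩ := hdec.norm_timeDerivWithin_le_rpow hsm hU 6
  have e6 : (-((6 : ℕ) : ℝ)) = -(6 : ℝ) := by norm_num
  set B : ℝ := A0 + A1 + A2 with hB
  have hB0 : 0 ≤ B := by positivity
  have hw0 : ∀ y : EuclideanSpace ℝ (Fin 3), 0 ≤ (1 + ‖y‖) ^ (-(6 : ℝ)) := fun y => by positivity
  have hw65 : ∀ y : EuclideanSpace ℝ (Fin 3), (1 + ‖y‖) ^ (-(6 : ℝ)) ≤ (1 + ‖y‖) ^ (-(5 : ℝ)) := fun y =>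
    Real.rpow_le_rpow_of_exponent_le (by linarith [norm_nonneg y]) (by norm_num)
  have hw61 : ∀ y : EuclideanSpace ℝ (Fin 3), (1 + ‖y‖) ^ (-(6 : ℝ)) ≤ 1 := fun y =>
    Real.rpow_le_one_of_one_le_of_nonpos (by linarith [norm_nonneg y]) (by norm_num)
  have hyw : ∀ y : EuclideanSpace ℝ (Fin 3), ‖y‖ * (1 + ‖y‖) ^ (-(6 : ℝ)) ≤ (1 + ‖y‖) ^ (-(5 : ℝ)) := by
    intro y
    have h := norm_pow_mul_rpow_neg_le y 1 6
    rw [pow_one] at h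
    exact h.trans (by norm_num)
  have hV0 : ∀ y, ‖W σ y‖ ≤ B * (1 + ‖y‖) ^ (-(6 : ℝ)) := fun y =>
    le_mul_weight_of_le (by rw [← e6]; exact h0 σ hσ y) (by rw [hB]; linarith) (hw0 y)
  have hV1b : ∀ y, ‖fderiv ℝ (W σ) y‖ ≤ B * (1 + ‖y‖) ^ (-(6 : ℝ)) := fun y =>
    le_mul_weight_of_le (by rw [← e6]; exact h1 σ hσ y) (by rw [hB]; linarith) (hw0 y)
  have hV2b : ∀ y, ‖fderiv ℝ (fderiv ℝ (W σ)) y‖ ≤ B * (1 + ‖y‖) ^ (-(6 : ℝ)) := fun y =>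
    le_mul_weight_of_le (by rw [← e6]; exact h2 σ hσ y) (by rw [hB]; linarith) (hw0 y)
  -- the momentum equation, solved for `∂_σ W`
  have hmom : ∀ y, timeDerivWithin Set.univ W σ y =
      ε • (Δ (W σ)) y - gradient (q σ) y + -((ε / 2) • (W σ y + fderiv ℝ (W σ) y y)) -
        convect (W σ) (W σ) y := by
    intro y
    have h := hsol.momentum σ hσ y
    rw [← h]; abel
  -- decay of the pressure gradient: `∇q = εΔW − ∂_σW − (W·∇)W + f`
  set Cq : ℝ := ε * (3 * A2) + A3 + A1 * A0 + ε / 2 * (A0 + A1) with hCq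
  have hCq0 : 0 ≤ Cq := by positivity
  have hgq : ∀ y, ‖gradient (q σ) y‖ ≤ Cq * (1 + ‖y‖) ^ (-(5 : ℝ)) := by
    intro y
    have hg : gradient (q σ) y = ε • (Δ (W σ)) y - timeDerivWithin Set.univ W σ y -
        convect (W σ) (W σ) y + -((ε / 2) • (W σ y + fderiv ℝ (W σ) y y)) := by
      rw [hmom y]; abel
    have hΔ : ‖(Δ (W σ)) y‖ ≤ 3 * (A2 * (1 + ‖y‖) ^ (-(6 : ℝ))) := by
      have h := norm_laplacian_le (W σ) y
      rw [finrank_euclideanSpace_fin] at h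
      have h2' := h2 σ hσ y
      rw [e6] at h2'
      calc ‖(Δ (W σ)) y‖ ≤ (3 : ℕ) * ‖fderiv ℝ (fderiv ℝ (W σ)) y‖ := h
        _ ≤ 3 * (A2 * (1 + ‖y‖) ^ (-(6 : ℝ))) := by push_cast; gcongr
    have hT : ‖timeDerivWithin Set.univ W σ y‖ ≤ A3 * (1 + ‖y‖) ^ (-(6 : ℝ)) := by
      rw [← e6]; exact h3 σ hσ y
    have hC : ‖convect (W σ) (W σ) y‖ ≤ A1 * A0 * (1 + ‖y‖) ^ (-(6 : ℝ)) := by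
      rw [convect_apply]
      have ha := h1 σ hσ y; have hb := h0 σ hσ y
      rw [e6] at ha hb
      calc ‖fderiv ℝ (W σ) y (W σ y)‖ ≤ ‖fderiv ℝ (W σ) y‖ * ‖W σ y‖ := ContinuousLinearMap.le_opNorm _ _
        _ ≤ (A1 * (1 + ‖y‖) ^ (-(6 : ℝ))) * (A0 * (1 + ‖y‖) ^ (-(6 : ℝ))) := by
            gcongr
        _ ≤ (A1 * (1 + ‖y‖) ^ (-(6 : ℝ))) * (A0 * 1) := by gcongr; exact hw61 y
        _ = A1 * A0 * (1 + ‖y‖) ^ (-(6 : ℝ)) := by ring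
    have hF : ‖-((ε / 2) • (W σ y + fderiv ℝ (W σ) y y))‖ ≤ ε / 2 * (A0 + A1) * (1 + ‖y‖) ^ (-(5 : ℝ)) := by
      have ha := h1 σ hσ y; have hb := h0 σ hσ y
      rw [e6] at ha hb
      rw [norm_neg, norm_smul, Real.norm_of_nonneg (by positivity)]
      have hD : ‖fderiv ℝ (W σ) y y‖ ≤ A1 * (1 + ‖y‖) ^ (-(5 : ℝ)) :=
        calc ‖fderiv ℝ (W σ) y y‖ ≤ ‖fderiv ℝ (W σ) y‖ * ‖y‖ := ContinuousLinearMap.le_opNorm _ _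
          _ ≤ (A1 * (1 + ‖y‖) ^ (-(6 : ℝ))) * ‖y‖ := by gcongr
          _ = A1 * (‖y‖ * (1 + ‖y‖) ^ (-(6 : ℝ))) := by ring
          _ ≤ A1 * (1 + ‖y‖) ^ (-(5 : ℝ)) := by gcongr; exact hyw y
      have hW : ‖W σ y‖ ≤ A0 * (1 + ‖y‖) ^ (-(5 : ℝ)) :=
        hb.trans (mul_le_mul_of_nonneg_left (hw65 y) hA0)
      calc ε / 2 * ‖W σ y + fderiv ℝ (W σ) y y‖ ≤ ε / 2 * (‖W σ y‖ + ‖fderiv ℝ (W σ) y y‖) := by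
            gcongr; exact norm_add_le _ _
        _ ≤ ε / 2 * (A0 * (1 + ‖y‖) ^ (-(5 : ℝ)) + A1 * (1 + ‖y‖) ^ (-(5 : ℝ))) := by gcongr
        _ = ε / 2 * (A0 + A1) * (1 + ‖y‖) ^ (-(5 : ℝ)) := by ring
    rw [hg]
    have hE : ‖ε • (Δ (W σ)) y‖ ≤ ε * (3 * (A2 * (1 + ‖y‖) ^ (-(6 : ℝ)))) := by
      rw [norm_smul, Real.norm_of_nonneg hε.le]
      exact mul_le_mul_of_nonneg_left hΔ hε.le
    have htri : ‖ε • (Δ (W σ)) y - timeDerivWithin Set.univ W σ y - convect (W σ) (W σ) y +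
          -((ε / 2) • (W σ y + fderiv ℝ (W σ) y y))‖
        ≤ ‖ε • (Δ (W σ)) y‖ + ‖timeDerivWithin Set.univ W σ y‖ + ‖convect (W σ) (W σ) y‖ +
          ‖-((ε / 2) • (W σ y + fderiv ℝ (W σ) y y))‖ :=
      (norm_add_le _ _).trans (add_le_add ((norm_sub_le _ _).trans
        (add_le_add (norm_sub_le _ _) le_rfl)) le_rfl)
    have m1 : ε * (3 * (A2 * (1 + ‖y‖) ^ (-(6 : ℝ)))) ≤ ε * (3 * (A2 * (1 + ‖y‖) ^ (-(5 : ℝ)))) := by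
      have := mul_le_mul_of_nonneg_left (hw65 y) hA2
      nlinarith [hε.le]
    have m2 : A3 * (1 + ‖y‖) ^ (-(6 : ℝ)) ≤ A3 * (1 + ‖y‖) ^ (-(5 : ℝ)) :=
      mul_le_mul_of_nonneg_left (hw65 y) hA3
    have m3 : A1 * A0 * (1 + ‖y‖) ^ (-(6 : ℝ)) ≤ A1 * A0 * (1 + ‖y‖) ^ (-(5 : ℝ)) :=
      mul_le_mul_of_nonneg_left (hw65 y) (by positivity)
    have hfin : ε * (3 * (A2 * (1 + ‖y‖) ^ (-(5 : ℝ)))) + A3 * (1 + ‖y‖) ^ (-(5 : ℝ)) +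
        A1 * A0 * (1 + ‖y‖) ^ (-(5 : ℝ)) + ε / 2 * (A0 + A1) * (1 + ‖y‖) ^ (-(5 : ℝ)) =
        Cq * (1 + ‖y‖) ^ (-(5 : ℝ)) := by rw [hCq]; ring
    linarith
  -- the five integrals
  have hΔ0 := integral_cross_laplacian_apply_eq_zero hV2 hdivV hB0 hV1b hV2b i
  have hC0 := integral_cross_convect_apply_eq_zero hV1 hdivV hB0 hV0 hV1b i
  have hP0 := integral_cross_gradient_apply_eq_zero hq1 hCq0 hgq i
  have hD4 := integral_cross_fderiv_apply_self_eq hV1 hB0 hV0 hV1b i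
  -- integrability of the pieces
  have hIΔ : Integrable (fun y : EuclideanSpace ℝ (Fin 3) => cross y ((Δ (W σ)) y) i) := by
    refine integrable_cross_apply_of_norm_le (continuous_laplacian hV2) (C := 3 * A2) (by positivity)
      (fun y => ?_) i
    have h := norm_laplacian_le (W σ) y
    rw [finrank_euclideanSpace_fin] at h
    have h2' := h2 σ hσ y
    rw [e6] at h2'
    calc ‖(Δ (W σ)) y‖ ≤ (3 : ℕ) * ‖fderiv ℝ (fderiv ℝ (W σ)) y‖ := h
      _ ≤ 3 * (A2 * (1 + ‖y‖) ^ (-(6 : ℝ))) := by push_cast; gcongr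
      _ ≤ 3 * (A2 * (1 + ‖y‖) ^ (-(5 : ℝ))) :=
          mul_le_mul_of_nonneg_left (mul_le_mul_of_nonneg_left (hw65 y) hA2) (by norm_num)
      _ = 3 * A2 * (1 + ‖y‖) ^ (-(5 : ℝ)) := by ring
  have hIq : Integrable (fun y : EuclideanSpace ℝ (Fin 3) => cross y (gradient (q σ) y) i) :=
    integrable_cross_apply_of_norm_le (continuous_gradient_of_contDiff hq1) hCq0 hgq i
  have hIW : Integrable (fun y : EuclideanSpace ℝ (Fin 3) => cross y (W σ y) i) :=
    integrable_cross_apply_of_norm_le hV.continuous hB0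
      (fun y => (hV0 y).trans (mul_le_mul_of_nonneg_left (hw65 y) hB0)) i
  have hIDy : Integrable (fun y : EuclideanSpace ℝ (Fin 3) => cross y (fderiv ℝ (W σ) y y) i) := by
    refine integrable_cross_apply_of_norm_le ((hV1.continuous_fderiv one_ne_zero).clm_apply continuous_id)
      hB0 (fun y => ?_) i
    calc ‖fderiv ℝ (W σ) y y‖ ≤ ‖fderiv ℝ (W σ) y‖ * ‖y‖ := ContinuousLinearMap.le_opNorm _ _
      _ ≤ (B * (1 + ‖y‖) ^ (-(6 : ℝ))) * ‖y‖ := by gcongr; exact hV1b y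
      _ = B * (‖y‖ * (1 + ‖y‖) ^ (-(6 : ℝ))) := by ring
      _ ≤ B * (1 + ‖y‖) ^ (-(5 : ℝ)) := by gcongr; exact hyw y
  have hIC : Integrable (fun y : EuclideanSpace ℝ (Fin 3) => cross y (convect (W σ) (W σ) y) i) := by
    refine integrable_cross_apply_of_norm_le ((hV1.continuous_fderiv one_ne_zero).clm_apply hV.continuous)
      (C := B * B) (by positivity) (fun y => ?_) i
    show ‖fderiv ℝ (W σ) y (W σ y)‖ ≤ B * B * (1 + ‖y‖) ^ (-(5 : ℝ))
    calc ‖fderiv ℝ (W σ) y (W σ y)‖ ≤ ‖fderiv ℝ (W σ) y‖ * ‖W σ y‖ := ContinuousLinearMap.le_opNorm _ _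
      _ ≤ (B * (1 + ‖y‖) ^ (-(6 : ℝ))) * (B * (1 + ‖y‖) ^ (-(6 : ℝ))) :=
          mul_le_mul (hV1b y) (hV0 y) (norm_nonneg _) (by positivity)
      _ ≤ (B * (1 + ‖y‖) ^ (-(5 : ℝ))) * (B * 1) :=
          mul_le_mul (mul_le_mul_of_nonneg_left (hw65 y) hB0) (mul_le_mul_of_nonneg_left (hw61 y) hB0)
            (by positivity) (by positivity)
      _ = B * B * (1 + ‖y‖) ^ (-(5 : ℝ)) := by ring
  -- pointwise expansion of `(y × ∂_σW)ᵢ`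
  have hpt : ∀ y, cross y (timeDerivWithin Set.univ W σ y) i =
      ε * cross y ((Δ (W σ)) y) i - cross y (gradient (q σ) y) i -
        (ε / 2 * cross y (W σ y) i + ε / 2 * cross y (fderiv ℝ (W σ) y y) i) -
        cross y (convect (W σ) (W σ) y) i := by
    intro y
    rw [hmom y, ← crossCLM_apply, map_sub, map_add, map_sub, map_smul, map_neg, map_smul, map_add]
    simp only [crossCLM_apply, PiLp.sub_apply, PiLp.add_apply, PiLp.smul_apply, PiLp.neg_apply,
      smul_eq_mul]
    ring
  have hC0' : ∫ y, cross y (convect (W σ) (W σ) y) i = 0 := by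
    simpa only [convect_apply] using hC0
  simp_rw [hpt]
  have hI1 : Integrable (fun y : EuclideanSpace ℝ (Fin 3) => ε * cross y ((Δ (W σ)) y) i) := hIΔ.const_mul ε
  have hI2 : Integrable (fun y : EuclideanSpace ℝ (Fin 3) =>
      ε * cross y ((Δ (W σ)) y) i - cross y (gradient (q σ) y) i) := hI1.sub hIq
  have hI3 : Integrable (fun y : EuclideanSpace ℝ (Fin 3) => ε / 2 * cross y (W σ y) i) := hIW.const_mul _
  have hI4 : Integrable (fun y : EuclideanSpace ℝ (Fin 3) => ε / 2 * cross y (fderiv ℝ (W σ) y y) i) :=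
    hIDy.const_mul _
  have hI5 : Integrable (fun y : EuclideanSpace ℝ (Fin 3) =>
      ε / 2 * cross y (W σ y) i + ε / 2 * cross y (fderiv ℝ (W σ) y y) i) := hI3.add hI4
  have hI6 : Integrable (fun y : EuclideanSpace ℝ (Fin 3) =>
      ε * cross y ((Δ (W σ)) y) i - cross y (gradient (q σ) y) i -
        (ε / 2 * cross y (W σ y) i + ε / 2 * cross y (fderiv ℝ (W σ) y y) i)) := hI2.sub hI5
  rw [integral_sub hI6 hIC, integral_sub hI2 hI5, integral_sub hI1 hIq, integral_add hI3 hI4,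
    integral_const_mul, integral_const_mul, integral_const_mul, hΔ0, hP0, hD4, hC0']
  ring


/-- **Law (ii) of item stmt-NavierStokesRegularity-1419 (`EulerMelnikovDss.PeriodMomentLaws`), the
ANGULAR-IMPULSE law**, exactly in the item's shape: for `ε > 0` and a classical solution `(W, q)` of
the rescaled Euler–Leray system `∂_σW + (W·∇)W + ∇q = ε(ΔW − ½(W + (y·∇)W))` on `ℝ × ℝ³` with
uniformly rapidly decaying velocity,
`d/dσ ∫ |y|² curl W(σ) dy = (3ε/2) ∫ |y|² curl W(σ) dy` at every `σ`.
Proof: differentiate under the integral sign (domination by the uniform decay of `D∂_σW`,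
`hasDerivWithinAt_integral_of_dominated_convex`, `∂_σ curl = curl ∂_σ`); componentwise
`∫ |y|² curl V = −2 ∫ y × V` for `V = ∂_σW(σ)` and `V = W(σ)` (`integral_normSq_mul_curl_apply`),
and `∫ y × ∂_σW(σ) = (3ε/2) ∫ y × W(σ)` (`integral_cross_timeDerivWithin_apply_eq`).
[cite: Saffman1992, §3.5] -/
theorem angularImpulse_law (hε : 0 < ε)
    (hsol : IsClassicalNSSolutionOn Set.univ ε
      (fun σ y => -((ε / 2) • (W σ y + fderiv ℝ (W σ) y y))) W q)
    (hdec : HasUniformRapidDecayOn Set.univ W) (σ : ℝ) :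
    HasDerivAt (fun s => ∫ y, (‖y‖ ^ 2) • curl (W s) y)
      ((3 * ε / 2) • ∫ y, (‖y‖ ^ 2) • curl (W σ) y) σ := by
  have hU : UniqueDiffOn ℝ (Set.univ : Set ℝ) := uniqueDiffOn_univ
  have hsm := hsol.smooth_velocity
  have hσ : σ ∈ (Set.univ : Set ℝ) := mem_univ σ
  have hcl : (Set.univ : Set ℝ) ⊆ closure (interior Set.univ) := by simp
  have hV1 : ∀ s, ContDiff ℝ 1 (W s) := fun s => (hsol.contDiff_velocity (mem_univ s)).of_le (by norm_cast)
  have hTsm : IsSmoothSpaceTimeOn Set.univ (timeDerivWithin Set.univ W) := hsm.timeDerivWithin hU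
  have hT1 : ∀ s, ContDiff ℝ 1 (timeDerivWithin Set.univ W s) := fun s =>
    (hTsm.contDiff_slice (mem_univ s)).of_le (by norm_cast)
  have hωst : IsSmoothSpaceTimeOn Set.univ (vorticity W) := (hsm.fderiv_slice hU).clm_comp curlCLM
  -- decay constants
  obtain ⟨A0, hA0, h0⟩ := hdec.norm_le_rpow 6
  obtain ⟨A1, hA1, h1⟩ := hdec.norm_fderiv_le_rpow hsm hU 6
  obtain ⟨A3, hA3, h3⟩ := hdec.norm_timeDerivWithin_le_rpow hsm hU 6
  obtain ⟨A4, hA4, h4⟩ := hdec.norm_fderiv_timeDerivWithin_le_rpow hsm hU 6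
  have e6 : (-((6 : ℕ) : ℝ)) = -(6 : ℝ) := by norm_num
  have hw0 : ∀ y : EuclideanSpace ℝ (Fin 3), 0 ≤ (1 + ‖y‖) ^ (-(6 : ℝ)) := fun y => by positivity
  set B : ℝ := A0 + A1 + A3 + A4 with hB
  have hB0 : 0 ≤ B := by positivity
  have hV0 : ∀ s y, ‖W s y‖ ≤ B * (1 + ‖y‖) ^ (-(6 : ℝ)) := fun s y =>
    le_mul_weight_of_le (by rw [← e6]; exact h0 s (mem_univ s) y) (by rw [hB]; linarith) (hw0 y)
  have hV1b : ∀ s y, ‖fderiv ℝ (W s) y‖ ≤ B * (1 + ‖y‖) ^ (-(6 : ℝ)) := fun s y =>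
    le_mul_weight_of_le (by rw [← e6]; exact h1 s (mem_univ s) y) (by rw [hB]; linarith) (hw0 y)
  have hT0 : ∀ s y, ‖timeDerivWithin Set.univ W s y‖ ≤ B * (1 + ‖y‖) ^ (-(6 : ℝ)) := fun s y =>
    le_mul_weight_of_le (by rw [← e6]; exact h3 s (mem_univ s) y) (by rw [hB]; linarith) (hw0 y)
  have hT1b : ∀ s y, ‖fderiv ℝ (timeDerivWithin Set.univ W s) y‖ ≤ B * (1 + ‖y‖) ^ (-(6 : ℝ)) :=
    fun s y => le_mul_weight_of_le (by rw [← e6]; exact h4 s (mem_univ s) y) (by rw [hB]; linarith) (hw0 y)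
  -- the integrand and its `σ`-derivative
  set F : ℝ → EuclideanSpace ℝ (Fin 3) → EuclideanSpace ℝ (Fin 3) :=
    fun s y => (‖y‖ ^ 2) • curl (W s) y with hFdef
  set F' : ℝ → EuclideanSpace ℝ (Fin 3) → EuclideanSpace ℝ (Fin 3) :=
    fun s y => (‖y‖ ^ 2) • curl (timeDerivWithin Set.univ W s) y with hF'def
  -- pointwise bound `‖ |y|² curl V ‖ ≤ ‖curlCLM‖ B ‖y‖² (1+‖y‖)⁻⁶ ≤ ‖curlCLM‖ B (1+‖y‖)⁻⁴`
  have hbd : ∀ (V : EuclideanSpace ℝ (Fin 3) → EuclideanSpace ℝ (Fin 3)),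
      (∀ y, ‖fderiv ℝ V y‖ ≤ B * (1 + ‖y‖) ^ (-(6 : ℝ))) →
      ∀ y, ‖(‖y‖ ^ 2) • curl V y‖ ≤ ‖curlCLM‖ * B * (‖y‖ ^ 2 * (1 + ‖y‖) ^ (-(6 : ℝ))) := by
    intro V hV y
    rw [norm_smul, norm_pow, norm_norm]
    calc ‖y‖ ^ 2 * ‖curl V y‖ ≤ ‖y‖ ^ 2 * (‖curlCLM‖ * (B * (1 + ‖y‖) ^ (-(6 : ℝ)))) :=
          mul_le_mul_of_nonneg_left ((norm_curl_le V y).trans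
            (mul_le_mul_of_nonneg_left (hV y) (ContinuousLinearMap.opNorm_nonneg curlCLM))) (sq_nonneg _)
      _ = ‖curlCLM‖ * B * (‖y‖ ^ 2 * (1 + ‖y‖) ^ (-(6 : ℝ))) := by ring
  have hκB : 0 ≤ ‖curlCLM‖ * B := mul_nonneg (ContinuousLinearMap.opNorm_nonneg _) hB0
  have hcontF : ∀ (V : EuclideanSpace ℝ (Fin 3) → EuclideanSpace ℝ (Fin 3)), ContDiff ℝ 1 V →
      Continuous (fun y : EuclideanSpace ℝ (Fin 3) => (‖y‖ ^ 2) • curl V y) := fun V hV =>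
    (continuous_norm.pow 2).smul (continuous_curl hV)
  have hintF : ∀ (V : EuclideanSpace ℝ (Fin 3) → EuclideanSpace ℝ (Fin 3)), ContDiff ℝ 1 V →
      (∀ y, ‖fderiv ℝ V y‖ ≤ B * (1 + ‖y‖) ^ (-(6 : ℝ))) →
      Integrable (fun y : EuclideanSpace ℝ (Fin 3) => (‖y‖ ^ 2) • curl V y) := fun V hV hVb =>
    integrable_of_norm_le_pow_mul_rpow (hcontF V hV) (k := 2) (a := 6) hκB (by norm_num) (hbd V hVb)
  -- differentiate under the integral sign
  have hmeas : ∀ s ∈ (Set.univ : Set ℝ), AEStronglyMeasurable (F s) volume := fun s _ =>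
    (hcontF (W s) (hV1 s)).aestronglyMeasurable
  have hFint : Integrable (F σ) := hintF (W σ) (hV1 σ) (hV1b σ)
  have hbound : Integrable (fun y : EuclideanSpace ℝ (Fin 3) => ‖curlCLM‖ * B * (1 + ‖y‖) ^ (-(4 : ℝ))) :=
    (integrable_one_add_norm finrank_three_lt_four).const_mul _
  have hdom : ∀ s ∈ (Set.univ : Set ℝ), ∀ y, ‖F' s y‖ ≤ ‖curlCLM‖ * B * (1 + ‖y‖) ^ (-(4 : ℝ)) := by
    intro s _ y
    refine (hbd _ (hT1b s) y).trans (mul_le_mul_of_nonneg_left ?_ hκB)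
    exact (norm_pow_mul_rpow_neg_le y 2 6).trans (by norm_num)
  have hdiff : ∀ s ∈ (Set.univ : Set ℝ), ∀ y, HasDerivWithinAt (fun s' => F s' y) (F' s y) Set.univ s := by
    intro s _ y
    have h1 := hωst.hasDerivWithinAt_timeDerivWithin hU (mem_univ s) y
    have h2 : HasDerivWithinAt (fun s' => (‖y‖ ^ 2) • vorticity W s' y)
        ((‖y‖ ^ 2) • timeDerivWithin Set.univ (vorticity W) s y) Set.univ s := h1.fun_const_smul _
    rw [← hsm.curl_timeDerivWithin hU hcl (mem_univ s) y] at h2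
    simpa only [hFdef, hF'def, vorticity_apply] using h2
  have hD := hasDerivWithinAt_integral_of_dominated_convex convex_univ hσ hmeas hFint hdom hbound hdiff
  -- the derivative: `∫ |y|² curl ∂_σW(σ) = (3ε/2) ∫ |y|² curl W(σ)`
  have hF'int : Integrable (F' σ) := hintF _ (hT1 σ) (hT1b σ)
  have key : ∫ y, F' σ y = (3 * ε / 2) • ∫ y, F σ y := by
    ext i
    rw [eval_integral_piLp (Integrable.eval_piLp hF'int) i, PiLp.smul_apply,
      eval_integral_piLp (Integrable.eval_piLp hFint) i, smul_eq_mul]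
    simp only [hFdef, hF'def, PiLp.smul_apply, smul_eq_mul]
    rw [integral_normSq_mul_curl_apply (hT1 σ) hB0 (hT0 σ) (hT1b σ) i,
      integral_normSq_mul_curl_apply (hV1 σ) hB0 (hV0 σ) (hV1b σ) i,
      integral_cross_timeDerivWithin_apply_eq hε hsol hdec σ i]
    ring
  rw [key] at hD
  exact hD.hasDerivAt Filter.univ_mem
end Law

end PeriodMomentLaws

end Summit.NavierStokesRegularity.NavierStokesRegularity.Theorems

end
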